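import Literature.AlgebraicGeometry.Frobenioids.Isotropification
import Literature.AlgebraicGeometry.Frobenioids.DivisorMonoidCategoryTheoreticity
import Literature.AlgebraicGeometry.Frobenioids.PreFrobenioidDataOfFunctor
import HarnessLib

/-!
# [FrdI] Theorem 4.9, sub-node T49-L01 `IsotropicNonGroupLikeWLOG`: "we may assume that `C₁`, `C₂` are of
# isotropic type … but not of group-like type" — the transport from the isotropic objects, and the
# group-like case — PROVED

Mochizuki, *The geometry of Frobenioids I: the general theory*, Kyushu J. Math. **62** (2008) 293–400,
§4, proof of Theorem 4.9, kurims text p. 89 ll. 3–5 [cite: MochizukiFrdI2008, Thm. 4.9 p.89]: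

> "First, we observe [cf. Theorem 3.4, (i), (ii)] that we may assume without loss of generality that `C₁`,
> `C₂` are of isotropic type [cf. Remark 4.5.1], but not of group-like type [since Theorem 4.9 is vacuous
> if `C₁`, `C₂` are of group-like type]."

PROOF-ONLY companion (seat abc-iut-w4-d109, L1-lead R91 (3)) of the S5 sub-DAG row T49-L01, typed by seat
abc-iut-w5-d021 in `Thm49SubII.lean` (v2, row text `staging/L1/w5-d021/Thm49RowsL01L05.snippet.lean`) as the
TRANSPORT its use requires: an isomorphism of functors `Φ₁ ⥲ Φ₂` over `Ψ` given on the ISOTROPIC objects of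
`C₁` only (natural along all arrows between isotropic objects) extends to `Ψ^Φ : Φ₁ ⥲ Φ₂` over `Ψ` on all of
`C₁` — the closing shape `PreFrobenioidData.DivisorMonoidIsoOver` of abc-iut-L1-t3's typed `Thm49`. The
extension transports along the isotropic hulls `h_A : A → A^istr` (Def. 1.3 (vii)(a), an isometric pre-step,
so `Base(h_A)` is invertible): `Ψ^Φ_A := Base(Ψ h_A)^* ∘ m_{A^istr} ∘ (Base(h_A)⁻¹)^*`; it is natural by
`h_A ≫ φ^istr = φ ≫ h_B` (Prop. 1.9 (v)) and the naturality of `m` along `φ^istr`, and it is an ISOMORPHISM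
because `Ψ(h_A)` is again an isotropic hull (Thm. 3.4 (i): "`Ψ` preserves … isotropic hulls" — the one input
beyond the row's first draft, cf. this seat's binder request 2026-08-26T01:13Z), so that `Base(Ψ h_A)` is
invertible too. Also the group-like case ("vacuous"): when `C₁`, `C₂` are of group-like type all the
`Φ_i(A)` are trivial and `Ψ^Φ` exists trivially.
* `FrdI.T49.nonempty_divisorMonoidIsoOver_of_isotropic` — T49-L01 in the binders of the typed row plus the
  hull binder;
* `FrdI.T49.nonempty_divisorMonoidIsoOver_of_isOfGroupLikeType` — the group-like case.
No new definitions; nothing of [FrdI] restated; nothing here bears on [IUTchIII] Cor. 3.12.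
-/

namespace Literature.AlgebraicGeometry.Frobenioids

open CategoryTheory Opposite

namespace FrdI.T49

universe w v v' u u'

variable {D₁ : Type u} [Category.{v} D₁] {Φ₁ : D₁ᵒᵖ ⥤ CommMonCat.{w}} {C₁ : Type u'} [Category.{v'} C₁]
  {D₂ : Type u} [Category.{v} D₂] {Φ₂ : D₂ᵒᵖ ⥤ CommMonCat.{w}} {C₂ : Type u'} [Category.{v'} C₂]

/-- **T49-L01 `IsotropicNonGroupLikeWLOG` — "we may assume without loss of generality that `C₁`, `C₂` are of
isotropic type [cf. Theorem 3.4, (i), (ii); Remark 4.5.1]"** (p. 89 ll. 3–5), as the transport its use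
requires: for Frobenioids `C_i → F_{Φ_i}` and an equivalence `Ψ` preserving isotropic objects and isotropic
hulls (Thm. 3.4 (i)), a family of isomorphisms of monoids `m_A : Φ₁(A) ≃ Φ₂(Ψ A)` on the ISOTROPIC objects `A`,
natural along all arrows between isotropic objects, extends to an isomorphism of functors `Ψ^Φ : Φ₁ ⥲ Φ₂`
lying over `Ψ` on all of `C₁` (transport along the isotropic hulls `A → A^istr`, Def. 1.3 (vii)(a),
Prop. 1.9 (v)). [cite: MochizukiFrdI2008, Thm. 4.9 p.89] -/
theorem nonempty_divisorMonoidIsoOver_of_isotropic (F₁ : C₁ ⥤ ElemFrobenioid Φ₁) (F₂ : C₂ ⥤ ElemFrobenioid Φ₂)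
    (Ψ : C₁ ≌ C₂) (hF₁ : PreFrobenioid.IsFrobenioid F₁) (_hF₂ : PreFrobenioid.IsFrobenioid F₂)
    (_hiso : ∀ A : C₁, PreFrobenioid.IsIsotropic F₁ A → PreFrobenioid.IsIsotropic F₂ (Ψ.functor.obj A))
    (hhull : ∀ ⦃A B : C₁⦄ (h : A ⟶ B),
      PreFrobenioid.IsIsotropicHull F₁ h → PreFrobenioid.IsIsotropicHull F₂ (Ψ.functor.map h))
    (m : ∀ A : C₁, PreFrobenioid.IsIsotropic F₁ A →
      (Φ₁.obj (op (PreFrobenioid.baseObj F₁ A)) ≃* Φ₂.obj (op (PreFrobenioid.baseObj F₂ (Ψ.functor.obj A)))))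
    (hm : ∀ ⦃A B : C₁⦄ (hA : PreFrobenioid.IsIsotropic F₁ A) (hB : PreFrobenioid.IsIsotropic F₁ B) (φ : A ⟶ B)
      (x : Φ₁.obj (op (PreFrobenioid.baseObj F₁ B))),
      m A hA (pull Φ₁ (PreFrobenioid.Base F₁ φ) x) =
        pull Φ₂ (PreFrobenioid.Base F₂ (Ψ.functor.map φ)) (m B hB x)) :
    Nonempty (PreFrobenioidData.DivisorMonoidIsoOver (PreFrobenioidData.ofFunctor Φ₁ F₁)
      (PreFrobenioidData.ofFunctor Φ₂ F₂) Ψ) := by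
  -- the isotropic hulls `h_A : A → A^istr` and the invertibility of `Base(h_A)`, `Base(Ψ h_A)`
  have hh : ∀ A : C₁, PreFrobenioid.IsIsotropicHull F₁ (PreFrobenioid.hullHom hF₁ A) :=
    fun A => PreFrobenioid.isIsotropicHull_hullHom hF₁ A
  have hA' : ∀ A : C₁, PreFrobenioid.IsIsotropic F₁ (PreFrobenioid.hullObj hF₁ A) := fun A => (hh A).2.2.1
  haveI i₁ : ∀ A : C₁, IsIso (PreFrobenioid.Base F₁ (PreFrobenioid.hullHom hF₁ A)) := fun A => (hh A).2.1.2
  haveI i₂ : ∀ A : C₁, IsIso (PreFrobenioid.Base F₂ (Ψ.functor.map (PreFrobenioid.hullHom hF₁ A))) :=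
    fun A => (hhull _ (hh A)).2.1.2
  -- the component at `A` and its inverse
  let f : ∀ A : C₁,
      Φ₁.obj (op (PreFrobenioid.baseObj F₁ A)) →* Φ₂.obj (op (PreFrobenioid.baseObj F₂ (Ψ.functor.obj A))) :=
    fun A => (pull Φ₂ (PreFrobenioid.Base F₂ (Ψ.functor.map (PreFrobenioid.hullHom hF₁ A)))).comp
      ((m _ (hA' A)).toMonoidHom.comp (pull Φ₁ (inv (PreFrobenioid.Base F₁ (PreFrobenioid.hullHom hF₁ A)))))
  let g : ∀ A : C₁,
      Φ₂.obj (op (PreFrobenioid.baseObj F₂ (Ψ.functor.obj A))) →* Φ₁.obj (op (PreFrobenioid.baseObj F₁ A)) :=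
    fun A => (pull Φ₁ (PreFrobenioid.Base F₁ (PreFrobenioid.hullHom hF₁ A))).comp
      ((m _ (hA' A)).symm.toMonoidHom.comp
        (pull Φ₂ (inv (PreFrobenioid.Base F₂ (Ψ.functor.map (PreFrobenioid.hullHom hF₁ A))))))
  have hgf : ∀ A, (g A).comp (f A) = MonoidHom.id _ := fun A => MonoidHom.ext fun x => by
    show pull Φ₁ _ ((m _ (hA' A)).symm (pull Φ₂ _ (pull Φ₂ _ ((m _ (hA' A)) (pull Φ₁ _ x))))) = x
    rw [← pull_comp, IsIso.inv_hom_id, pull_id, MulEquiv.symm_apply_apply, ← pull_comp, IsIso.hom_inv_id,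
      pull_id]
  have hfg : ∀ A, (f A).comp (g A) = MonoidHom.id _ := fun A => MonoidHom.ext fun y => by
    show pull Φ₂ _ ((m _ (hA' A)) (pull Φ₁ _ (pull Φ₁ _ ((m _ (hA' A)).symm (pull Φ₂ _ y))))) = y
    rw [← pull_comp, IsIso.inv_hom_id, pull_id, MulEquiv.apply_symm_apply, ← pull_comp, IsIso.hom_inv_id,
      pull_id]
  refine ⟨⟨fun A => MonoidHom.toMulEquiv (f A) (g A) (hgf A) (hfg A), fun A B φ x => ?_⟩⟩
  -- naturality: `Ψ^Φ_A (Base(φ)^* x) = Base(Ψ φ)^* (Ψ^Φ_B x)`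
  show f A (pull Φ₁ (PreFrobenioid.Base F₁ φ) x) = pull Φ₂ (PreFrobenioid.Base F₂ (Ψ.functor.map φ)) (f B x)
  show pull Φ₂ _ ((m _ (hA' A)) (pull Φ₁ _ (pull Φ₁ (PreFrobenioid.Base F₁ φ) x))) =
    pull Φ₂ _ (pull Φ₂ _ ((m _ (hA' B)) (pull Φ₁ _ x)))
  -- `(Base h_A)⁻¹ ≫ Base φ = Base φ^istr ≫ (Base h_B)⁻¹` (Prop. 1.9 (v): `h_A ≫ φ^istr = φ ≫ h_B`)
  have e1 : inv (PreFrobenioid.Base F₁ (PreFrobenioid.hullHom hF₁ A)) ≫ PreFrobenioid.Base F₁ φ =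
      PreFrobenioid.Base F₁ (PreFrobenioid.hullMor hF₁ φ) ≫
        inv (PreFrobenioid.Base F₁ (PreFrobenioid.hullHom hF₁ B)) := by
    rw [PreFrobenioid.base_hullMor hF₁ φ, Category.assoc, Category.assoc, IsIso.hom_inv_id, Category.comp_id]
  -- `Base(Ψ h_A) ≫ Base(Ψ φ^istr) = Base(Ψ φ) ≫ Base(Ψ h_B)`
  have e2 : PreFrobenioid.Base F₂ (Ψ.functor.map (PreFrobenioid.hullHom hF₁ A)) ≫
      PreFrobenioid.Base F₂ (Ψ.functor.map (PreFrobenioid.hullMor hF₁ φ)) =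
        PreFrobenioid.Base F₂ (Ψ.functor.map φ) ≫ PreFrobenioid.Base F₂ (Ψ.functor.map (PreFrobenioid.hullHom hF₁ B)) := by
    rw [← PreFrobenioid.base_comp, ← Ψ.functor.map_comp, PreFrobenioid.hullHom_hullMor hF₁ φ,
      Ψ.functor.map_comp, PreFrobenioid.base_comp]
  rw [← pull_comp, e1, pull_comp, hm (hA' A) (hA' B) (PreFrobenioid.hullMor hF₁ φ), ← pull_comp, e2,
    pull_comp]
  rfl

/-- **"[since Theorem 4.9 is vacuous if `C₁`, `C₂` are of group-like type]"** (p. 89 l. 5): if `C₁`, `C₂` are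
of group-like type (every `Φ_i(A)` trivial, Def. 1.2 (iv)/(v)), an isomorphism of functors `Ψ^Φ : Φ₁ ⥲ Φ₂`
lying over `Ψ` exists trivially. [cite: MochizukiFrdI2008, Thm. 4.9 p.89] -/
theorem nonempty_divisorMonoidIsoOver_of_isOfGroupLikeType (F₁ : C₁ ⥤ ElemFrobenioid Φ₁)
    (F₂ : C₂ ⥤ ElemFrobenioid Φ₂) (Ψ : C₁ ≌ C₂)
    (h₁ : (PreFrobenioidData.ofFunctor Φ₁ F₁).IsOfGroupLikeType)
    (h₂ : (PreFrobenioidData.ofFunctor Φ₂ F₂).IsOfGroupLikeType) :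
    Nonempty (PreFrobenioidData.DivisorMonoidIsoOver (PreFrobenioidData.ofFunctor Φ₁ F₁)
      (PreFrobenioidData.ofFunctor Φ₂ F₂) Ψ) := by
  refine ⟨⟨fun A =>
    { toFun := fun _ => 1
      invFun := fun _ => 1
      left_inv := fun x => (h₁.obj A x).symm
      right_inv := fun y => (h₂.obj (Ψ.functor.obj A) y).symm
      map_mul' := fun _ _ => (one_mul _).symm }, fun A B φ x => ?_⟩⟩
  exact (h₂.obj (Ψ.functor.obj A) _).trans (h₂.obj (Ψ.functor.obj A) _).symm

end FrdI.T49

end Literature.AlgebraicGeometry.Frobenioids
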